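import Literature.NumberTheory.EllipticCurves.Sprung2017.SharpFlatCombinationFunctionalEquationProofs
import Literature.NumberTheory.EllipticCurves.Sprung2017.SharpFlatPAdicLFunctionUniqueProofs
import Literature.NumberTheory.EllipticCurves.Sprung2017.SharpFlatFunctionalEquation
import Literature.NumberTheory.EllipticCurves.PlusMinusPAdicLFunctionProofs
import HarnessLib

/-!
# Sprung 2017, Cor. 4.14 at `a_p = 0` — the `ι`-WEIGHTS of the chromatic polynomials and their
# `p`-adic interpolation (proofs only; part 1 of the discharge of
# `cor414_sharpFlat_functionalEquation_apZero`)

A *proofs* companion (theorems only; no definition, no named fact) of `SharpFlatFunctionalEquation`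
(the named fact `cor414_sharpFlat_functionalEquation_apZero`: `L♯(T^ι) = σ(1+T)^{c+a}L♯`,
`L♭(T^ι) = σ(1+T)^{c+b}L♭` for a Sprung pair at `a_p = 0`, `(p+1)a = −p`, `(p+1)b = −1`), porting
§§1–3 and §5 of `Literature/Barriers/BirchSwinnertonDyer/PAdicFunctionalEquationSharpFlatTwoProofs`
(the `p = 2` THEOREM) from `p = 2` to an arbitrary prime `p`. Part 2
(`SharpFlatFunctionalEquationApZeroProofs`) transports the Mazur–Tate congruences under `T ↦ T^ι`
with these weights and concludes by uniqueness of the pair.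

## Contents (`Λ = ℤ_p⟦T⟧`, `ω_n = (1+T)^{pⁿ} − 1`, `ι = T^ι = (1+T)⁻¹ − 1`, `E = 1 + ι = (1+T)⁻¹`)

* §1 `exists_binomialSeries_sub_pow_eq_omega_mul` — `(1+T)^x ≡ (1+T)^m (mod ω_n)` for `x ≡ m (mod pⁿ)`
  (Mahler continuity of `x ↦ (1+T)^x` coefficientwise; as in the `p = 2` file).
* §2 `coe_cyclotomic_comp_mul_omega` (`Φ_{p^{k+1}}(1+T)·ω_k = ω_{k+1}`, Mathlib
  `cyclotomic_prime_pow_mul_X_pow_sub_one`), `subst_invOnePlusSubOne_cyclotomic_comp` —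
  **`Φ_{p^{k+1}}(1+T^ι) = E^{p^k(p−1)}·Φ_{p^{k+1}}(1+T)`** (from `ι(ω_j) = −E^{p^j}ω_j` and cancellation
  of `ω_k ≠ 0` in the domain `R⟦T⟧`).
* §3 `subst_invOnePlusSubOne_sprungSeq_zero`, `…sharpPoly_zero`, `…flatPoly_zero` — at `a_p = 0` the
  chromatic polynomials are `ι`-HOMOGENEOUS of weight `⌊pⁿ/(p+1)⌋`: `u_n(T^ι) = E^{⌊pⁿ/(p+1)⌋}u_n`,
  `v_n(T^ι) = E^{⌊pⁿ/(p+1)⌋}v_n` (`x_{n+2} = −Φ_{p^{n+1}}(1+T)x_n`, weights add: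
  `⌊p^{n+2}/(p+1)⌋ = pⁿ(p−1) + ⌊pⁿ/(p+1)⌋`).
* §4 `toZModPow_eq_pow_div_succ_of_odd/even` — the exponents of Sprung's units `W⁺ = (1+T)^{−a}`,
  `W⁻ = (1+T)^{−b}` (§3.5: `W⁺ = ∏_{j≥1}(1+T)^{−p^{2j−1}(p−1)}`, `W⁻ = ∏_{j≥1}(1+T)^{−p^{2j−2}(p−1)}`)
  INTERPOLATE the weights: `(p+1)a = −p ⇒ a ≡ ⌊pⁿ/(p+1)⌋ (mod pⁿ)` for odd `n`,
  `(p+1)b = −1 ⇒ b ≡ ⌊pⁿ/(p+1)⌋ (mod pⁿ)` for even `n` (`(p+1)⌊pⁿ/(p+1)⌋ = pⁿ − p` resp. `pⁿ − 1`).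

HONEST FRAMING: elementary algebra in `Λ`; BSD is not proved by any of this (consumer: the parity-stratum
theorems of crux item stmt-BirchSwinnertonDyer-19001). References: F. Sprung, ANT 11 (2017), §3.4
Prop. 3.14, §3.5 (the units `W^±`), §4 Cor. 4.4, Cor. 4.14 [Sprung2017]; Mazur–Tate–Teitelbaum,
Invent. Math. 84 (1986), §I.17 [MazurTateTeitelbaum1986Invent]; Greenberg, LNM 1716, §1 [GreenbergLNM1716].
-/

set_option autoImplicit false

noncomputable section

open scoped MatrixGroups ModularForm

open CongruenceSubgroup PowerSeries Literature.NumberTheory.EllipticCurves.ModularForms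
  Literature.Barriers.BirchSwinnertonDyer

namespace Literature.NumberTheory.EllipticCurves.Sprung2017

/-! ## §1. Binomial series with `p`-adic exponents modulo `ω_n` -/

section Binomial

variable {p : ℕ} [Fact p.Prime]

-- adapted from Literature/Barriers/BirchSwinnertonDyer/PAdicFunctionalEquationSharpFlatTwoProofs.lean §1
/-- `[T^e] G(ω) = Σ_{d ≤ e} [T^d]G · [T^e]ω^d` for `ω(0) = 0` (private plumbing). [folklore] -/
private theorem coeff_subst_eq_sum_range' {R : Type*} [CommRing R] {ω : R⟦X⟧} (hω : constantCoeff ω = 0)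
    (G : R⟦X⟧) (e : ℕ) :
    coeff e (G.subst ω) = ∑ d ∈ Finset.range (e + 1), coeff d G * coeff e (ω ^ d) := by
  rw [coeff_subst' (HasSubst.of_constantCoeff_zero' hω),
    finsum_eq_sum_of_support_subset _ (s := Finset.range (e + 1)) ?_]
  · simp only [smul_eq_mul]
  · intro d hd
    simp only [Function.mem_support, ne_eq, Finset.coe_range, Set.mem_Iio] at hd ⊢
    by_contra hlt
    apply hd
    rw [coeff_of_lt_order e (lt_of_lt_of_le (by exact_mod_cast (by omega : e < d))
      (natCast_le_order_pow hω d)), smul_zero]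

-- adapted from Literature/Barriers/BirchSwinnertonDyer/PAdicFunctionalEquationSharpFlatTwoProofs.lean §1
/-- `(1+T)^{k·y} = ((1+T)^k)^y` for `y ∈ ℤ_p`, `k ∈ ℕ` (Mahler continuity; private plumbing). [folklore] -/
private theorem binomialSeries_natCast_mul_eq_subst (k : ℕ) (y : ℤ_[p]) :
    PowerSeries.binomialSeries ℤ_[p] ((k : ℤ_[p]) * y) =
      (PowerSeries.binomialSeries ℤ_[p] y).subst ((1 + X : ℤ_[p]⟦X⟧) ^ k - 1) := by
  set ω : ℤ_[p]⟦X⟧ := (1 + X) ^ k - 1 with hωdef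
  have hω : constantCoeff ω = 0 := by simp [hωdef]
  have hωs : HasSubst ω := HasSubst.of_constantCoeff_zero' hω
  ext e
  suffices h : (fun z : ℤ_[p] ↦ coeff e (PowerSeries.binomialSeries ℤ_[p] ((k : ℤ_[p]) * z))) =
      fun z ↦ coeff e ((PowerSeries.binomialSeries ℤ_[p] z).subst ω) from congrFun h y
  apply Continuous.ext_on PadicInt.denseRange_natCast
  · simp only [binomialSeries_coeff, smul_eq_mul, mul_one]
    exact (PadicInt.continuous_choose e).comp (continuous_const.mul continuous_id)
  · have hform : (fun z : ℤ_[p] ↦ coeff e ((PowerSeries.binomialSeries ℤ_[p] z).subst ω)) =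
        fun z ↦ ∑ d ∈ Finset.range (e + 1), Ring.choose z d * coeff e (ω ^ d) := by
      funext z
      rw [coeff_subst_eq_sum_range' hω]
      simp only [binomialSeries_coeff, smul_eq_mul, mul_one]
    rw [hform]
    exact continuous_finsetSum _ fun d _ ↦ (PadicInt.continuous_choose d).mul continuous_const
  · rintro _ ⟨m, rfl⟩
    have h1 : ((k : ℤ_[p]) * (m : ℤ_[p])) = ((k * m : ℕ) : ℤ_[p]) := by push_cast; ring
    have hone : (1 : ℤ_[p]⟦X⟧).subst ω = 1 := by
      rw [← coe_substAlgHom hωs, map_one]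
    simp only
    rw [h1, binomialSeries_nat, binomialSeries_nat, subst_pow hωs, subst_add hωs, hone,
      subst_X hωs, pow_mul, hωdef, add_sub_cancel]

-- adapted from Literature/Barriers/BirchSwinnertonDyer/PAdicFunctionalEquationSharpFlatTwoProofs.lean §1
/-- `(1+T)^{pⁿy} ≡ 1 (mod ω_n)` in `Λ` (private plumbing). [folklore] -/
private theorem exists_binomialSeries_pow_mul_sub_one_eq (n : ℕ) (y : ℤ_[p]) :
    ∃ q : ℤ_[p]⟦X⟧, PowerSeries.binomialSeries ℤ_[p] (((p ^ n : ℕ) : ℤ_[p]) * y) - 1 =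
      ((1 + X : ℤ_[p]⟦X⟧) ^ (p ^ n) - 1) * q := by
  set ω : ℤ_[p]⟦X⟧ := (1 + X) ^ (p ^ n) - 1 with hωdef
  have hω : constantCoeff ω = 0 := by simp [hωdef]
  have hωs : HasSubst ω := HasSubst.of_constantCoeff_zero' hω
  set G : ℤ_[p]⟦X⟧ := PowerSeries.binomialSeries ℤ_[p] y with hG
  have hG1 : constantCoeff G = 1 := binomialSeries_constantCoeff y
  obtain ⟨H, hH⟩ : ∃ H : ℤ_[p]⟦X⟧, G - 1 = X * H := by
    refine ⟨PowerSeries.mk fun i ↦ coeff (i + 1) (G - 1), ?_⟩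
    ext i
    rcases i with _ | i
    · simp [coeff_zero_eq_constantCoeff_apply, hG1]
    · rw [coeff_succ_X_mul, coeff_mk]
  refine ⟨H.subst ω, ?_⟩
  rw [binomialSeries_natCast_mul_eq_subst, ← hωdef, ← hG]
  have hGe : G = 1 + X * H := by rw [← hH]; ring
  have hone : (1 : ℤ_[p]⟦X⟧).subst ω = 1 := by rw [← coe_substAlgHom hωs, map_one]
  conv_lhs => rw [hGe, subst_add hωs, hone, subst_mul hωs, subst_X hωs]
  ring

-- adapted from Literature/Barriers/BirchSwinnertonDyer/PAdicFunctionalEquationSharpFlatTwoProofs.lean §1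
/-- **`(1+T)^x ≡ (1+T)^m (mod ω_n)`** in `Λ` whenever `x ≡ m (mod pⁿ)` (`toZModPow n x = m`):
Greenberg's `⟨N⟩^{s−1} = (1+T)^c` read at the finite layer `Λ/ω_n = ℤ_p[Gal(ℚ_n/ℚ)]`, where only
`c mod pⁿ` matters. [cite: GreenbergLNM1716, §1 (pp. 67–68, the exponent of ⟨N_E⟩)] -/
theorem exists_binomialSeries_sub_pow_eq_omega_mul {n : ℕ} {x : ℤ_[p]} {m : ℕ}
    (hx : PadicInt.toZModPow n x = (m : ZMod (p ^ n))) :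
    ∃ q : ℤ_[p]⟦X⟧, PowerSeries.binomialSeries ℤ_[p] x - (1 + X : ℤ_[p]⟦X⟧) ^ m =
      ((1 + X : ℤ_[p]⟦X⟧) ^ (p ^ n) - 1) * q := by
  have hker : x - (m : ℤ_[p]) ∈ RingHom.ker (PadicInt.toZModPow (p := p) n) := by
    rw [RingHom.mem_ker, map_sub, map_natCast, hx, sub_self]
  rw [PadicInt.ker_toZModPow, Ideal.mem_span_singleton] at hker
  obtain ⟨y, hy⟩ := hker
  obtain ⟨q, hq⟩ := exists_binomialSeries_pow_mul_sub_one_eq n y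
  refine ⟨(1 + X : ℤ_[p]⟦X⟧) ^ m * q, ?_⟩
  have hx' : x = (m : ℤ_[p]) + ((p ^ n : ℕ) : ℤ_[p]) * y := by
    push_cast; linear_combination hy
  rw [hx', binomialSeries_add, binomialSeries_nat]
  linear_combination ((1 + X : ℤ_[p]⟦X⟧) ^ m) * hq

end Binomial

/-! ## §2. The involution: `E = 1 + ι = (1+T)⁻¹`, homogeneity of `Φ_{p^{k+1}}(1+T)` -/

section Iota

variable {R : Type*} [CommRing R]

/-- `(1+T)^k · E^k = 1` (private plumbing). [folklore] -/
private theorem one_add_X_pow_mul_E_pow (k : ℕ) :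
    (1 + X : R⟦X⟧) ^ k * (invOnePlusSubOne + 1) ^ k = 1 := by
  rw [← mul_pow, one_add_X_mul_invOnePlusSubOne_add_one, one_pow]

/-- `ι((1+T)^k) = E^k` (private plumbing). [folklore] -/
private theorem subst_invOnePlusSubOne_one_add_X_pow (k : ℕ) :
    ((1 + X : R⟦X⟧) ^ k).subst (invOnePlusSubOne : R⟦X⟧) = (invOnePlusSubOne + 1) ^ k := by
  have hι := hasSubst_invOnePlusSubOne (R := R)
  rw [subst_pow hι, subst_add hι, subst_X hι, ← coe_substAlgHom hι, map_one, add_comm]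

/-- `Φ_{p^{k+1}}(1+T) · ω_k = ω_{k+1}` as power series (`ω_j = (1+T)^{p^j} − 1`), from Mathlib's
`cyclotomic_prime_pow_mul_X_pow_sub_one` composed with `T ↦ 1+T` (private plumbing). [folklore] -/
private theorem coe_cyclotomic_comp_mul_omega (p : ℕ) [hp : Fact p.Prime] (k : ℕ) :
    ((((Polynomial.cyclotomic (p ^ (k + 1)) ℤ).comp (Polynomial.X + 1)).map (Int.castRingHom R) :
        Polynomial R) : R⟦X⟧) * ((1 + X : R⟦X⟧) ^ (p ^ k) - 1) =
      (1 + X : R⟦X⟧) ^ (p ^ (k + 1)) - 1 := by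
  have h := congr_arg (fun q : Polynomial ℤ ↦ (((q.comp (Polynomial.X + 1)).map (Int.castRingHom R) :
      Polynomial R) : R⟦X⟧)) (Polynomial.cyclotomic_prime_pow_mul_X_pow_sub_one ℤ p k)
  simp only [Polynomial.mul_comp, Polynomial.sub_comp, Polynomial.pow_comp, Polynomial.X_comp,
    Polynomial.one_comp, Polynomial.map_mul, Polynomial.map_sub, Polynomial.map_pow,
    Polynomial.map_add, Polynomial.map_X, Polynomial.map_one, Polynomial.coe_mul, Polynomial.coe_sub,
    Polynomial.coe_pow, Polynomial.coe_add, Polynomial.coe_X, Polynomial.coe_one] at h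
  rw [add_comm (X : R⟦X⟧) 1] at h
  exact h

/-- `ω_k = (1+T)^{p^k} − 1 ≠ 0` in `R⟦T⟧` for a nontrivial `R` (its `T^{p^k}`-coefficient is `1`).
Private plumbing. [folklore] -/
private theorem one_add_X_pow_sub_one_ne_zero [Nontrivial R] (p : ℕ) [hp : Fact p.Prime] (k : ℕ) :
    (1 + X : R⟦X⟧) ^ (p ^ k) - 1 ≠ 0 := by
  intro h
  have h1 : coeff (p ^ k) ((1 + X : R⟦X⟧) ^ (p ^ k) - 1) = 1 := by
    have hpoly : (1 + X : R⟦X⟧) ^ (p ^ k) - 1 =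
        (((Polynomial.X + 1) ^ (p ^ k) - 1 : Polynomial R) : R⟦X⟧) := by
      simp only [Polynomial.coe_sub, Polynomial.coe_pow, Polynomial.coe_add, Polynomial.coe_X,
        Polynomial.coe_one, add_comm]
    rw [hpoly, Polynomial.coeff_coe, Polynomial.coeff_sub, Polynomial.coeff_X_add_one_pow,
      Nat.choose_self, Polynomial.coeff_one, if_neg (pow_ne_zero k hp.out.ne_zero)]
    simp
  rw [h, map_zero] at h1
  exact zero_ne_one h1

/-- **`ι`-homogeneity of `Φ_{p^{k+1}}(1+T)`**: `Φ_{p^{k+1}}(1+T^ι) = E^{p^k (p−1)} · Φ_{p^{k+1}}(1+T)`,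
`E = (1+T)⁻¹` (the polynomial is palindromic in `1+T`; here from `Φ·ω_k = ω_{k+1}` and
`ι(ω_j) = −E^{p^j}ω_j`). [cite: Sprung2017, §3.4 Prop. 3.14 (invariance under 1+T ↦ 1/(1+T))] -/
theorem subst_invOnePlusSubOne_cyclotomic_comp [IsDomain R] (p : ℕ) [hp : Fact p.Prime] (k : ℕ) :
    ((((Polynomial.cyclotomic (p ^ (k + 1)) ℤ).comp (Polynomial.X + 1)).map (Int.castRingHom R) :
        Polynomial R) : R⟦X⟧).subst (invOnePlusSubOne : R⟦X⟧) =
      (invOnePlusSubOne + 1) ^ (p ^ k * (p - 1)) *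
        ((((Polynomial.cyclotomic (p ^ (k + 1)) ℤ).comp (Polynomial.X + 1)).map (Int.castRingHom R) :
          Polynomial R) : R⟦X⟧) := by
  have hι := hasSubst_invOnePlusSubOne (R := R)
  set Φ : R⟦X⟧ := ((((Polynomial.cyclotomic (p ^ (k + 1)) ℤ).comp (Polynomial.X + 1)).map
    (Int.castRingHom R) : Polynomial R) : R⟦X⟧) with hΦ
  set E : R⟦X⟧ := invOnePlusSubOne + 1 with hE
  have hmul := coe_cyclotomic_comp_mul_omega (R := R) p k
  rw [← hΦ] at hmul
  -- substitute `ι` in `Φ · ω_k = ω_{k+1}`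
  have hsub := congr_arg (PowerSeries.subst (invOnePlusSubOne : R⟦X⟧)) hmul
  rw [← coe_substAlgHom hι, map_mul, coe_substAlgHom hι, subst_invOnePlusSubOne_one_add_X_pow_sub_one,
    subst_invOnePlusSubOne_one_add_X_pow_sub_one, ← hE, ← hmul] at hsub
  -- cancel `ω_k ≠ 0`
  have hω : (1 + X : R⟦X⟧) ^ (p ^ k) - 1 ≠ 0 := one_add_X_pow_sub_one_ne_zero p k
  have hkey : Φ.subst (invOnePlusSubOne : R⟦X⟧) * E ^ (p ^ k) = E ^ (p ^ (k + 1)) * Φ := by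
    have h2 : (Φ.subst (invOnePlusSubOne : R⟦X⟧) * E ^ (p ^ k) - E ^ (p ^ (k + 1)) * Φ) *
        ((1 + X : R⟦X⟧) ^ (p ^ k) - 1) = 0 := by
      linear_combination (-1 : R⟦X⟧) * hsub
    exact sub_eq_zero.mp ((mul_eq_zero.mp h2).resolve_right hω)
  -- multiply by `(1+T)^{p^k}` and use `(1+T)^{p^k} E^{p^k} = 1`, `p^{k+1} = p^k (p-1) + p^k`
  have hPE := one_add_X_pow_mul_E_pow (R := R) (p ^ k)
  rw [← hE] at hPE
  have hexp : p ^ (k + 1) = p ^ k * (p - 1) + p ^ k := by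
    have h1 : 1 ≤ p := hp.out.one_lt.le
    zify [h1]
    ring
  calc Φ.subst (invOnePlusSubOne : R⟦X⟧)
      = Φ.subst (invOnePlusSubOne : R⟦X⟧) * E ^ (p ^ k) * (1 + X : R⟦X⟧) ^ (p ^ k) := by
        rw [mul_assoc, mul_comm (E ^ _), hPE, mul_one]
    _ = E ^ (p ^ k * (p - 1)) * Φ * (E ^ (p ^ k) * (1 + X : R⟦X⟧) ^ (p ^ k)) := by
        rw [hkey, hexp, pow_add]; ring
    _ = E ^ (p ^ k * (p - 1)) * Φ := by rw [mul_comm (E ^ (p ^ k)), hPE, mul_one]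

end Iota

/-! ## §3. `ι`-homogeneity of the chromatic polynomials at `a_p = 0` (any prime `p`) -/

section Homogeneity

variable {R : Type*} [CommRing R] [IsDomain R] (p : ℕ) [hp : Fact p.Prime]

/-- `⌊p^{n+2}/(p+1)⌋ = p^n (p−1) + ⌊p^n/(p+1)⌋` (the `ι`-weights `0, 0, p−1, p²−p, …`; private
plumbing). [folklore] -/
private theorem pow_add_two_div_succ (n : ℕ) : p ^ (n + 2) / (p + 1) = p ^ n * (p - 1) + p ^ n / (p + 1) := by
  have h1 : 1 ≤ p := hp.out.one_lt.le
  have h : p ^ (n + 2) = p ^ n + (p + 1) * (p ^ n * (p - 1)) := by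
    zify [h1]
    ring
  rw [h, Nat.add_mul_div_left _ _ (Nat.succ_pos p), add_comm]

omit [IsDomain R] hp in
/-- Sprung's recursion at `a_p = 0` for power series over `R`: `x_{n+2} = −Φ_{p^{n+1}}(1+T)·x_n`.
[cite: Sprung2017, §4 Cor. 4.4] -/
theorem coe_map_sprungSeq_zero_add_two (x₀ x₁ : Polynomial ℤ) (n : ℕ) :
    (((sprungSeq 0 p x₀ x₁ (n + 2)).map (Int.castRingHom R) : Polynomial R) : R⟦X⟧) =
      -(((((Polynomial.cyclotomic (p ^ (n + 1)) ℤ).comp (Polynomial.X + 1)).map (Int.castRingHom R) :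
          Polynomial R) : R⟦X⟧) *
        (((sprungSeq 0 p x₀ x₁ n).map (Int.castRingHom R) : Polynomial R) : R⟦X⟧)) := by
  rw [sprungSeq_add_two, Polynomial.C_0, zero_mul, zero_sub, Polynomial.map_neg,
    Polynomial.map_mul, Polynomial.coe_neg, Polynomial.coe_mul]

/-- **`ι`-homogeneity of a Sprung sequence with constant seeds** (`a_p = 0`): if `x₀ = C c₀`,
`x₁ = C c₁`, then `x_n(T^ι) = E^{⌊pⁿ/(p+1)⌋} · x_n(T)` with `E = (1+T)⁻¹`, for every `n` (each
step multiplies by `−Φ_{p^{n+1}}(1+T)`, homogeneous of `ι`-weight `pⁿ(p−1)`).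
[cite: Sprung2017, §3.5 (the weights W^±) and §4 Cor. 4.4] -/
theorem subst_invOnePlusSubOne_sprungSeq_zero (c₀ c₁ : ℤ) (n : ℕ) :
    ((((sprungSeq 0 p (Polynomial.C c₀) (Polynomial.C c₁) n).map (Int.castRingHom R) :
        Polynomial R) : R⟦X⟧)).subst (invOnePlusSubOne : R⟦X⟧) =
      (invOnePlusSubOne + 1) ^ (p ^ n / (p + 1)) *
        (((sprungSeq 0 p (Polynomial.C c₀) (Polynomial.C c₁) n).map (Int.castRingHom R) :
          Polynomial R) : R⟦X⟧) := by
  have hι := hasSubst_invOnePlusSubOne (R := R)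
  have hC : ∀ c : ℤ, ((((Polynomial.C c).map (Int.castRingHom R) : Polynomial R) : R⟦X⟧)).subst
      (invOnePlusSubOne : R⟦X⟧) = (((Polynomial.C c).map (Int.castRingHom R) : Polynomial R) :
        R⟦X⟧) := by
    intro c
    rw [Polynomial.map_C, Polynomial.coe_C, ← coe_substAlgHom hι, C_eq_algebraMap,
      AlgHom.commutes]
  have hlt1 : p ^ 0 / (p + 1) = 0 := Nat.div_eq_of_lt (by simpa using hp.out.pos)
  have hlt2 : p ^ 1 / (p + 1) = 0 := Nat.div_eq_of_lt (by simp)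
  induction n using Nat.strong_induction_on with
  | _ n ih =>
    match n with
    | 0 =>
      rw [sprungSeq_zero, hC, hlt1, pow_zero, one_mul]
    | 1 =>
      rw [sprungSeq_one, hC, hlt2, pow_zero, one_mul]
    | n + 2 =>
      rw [coe_map_sprungSeq_zero_add_two, ← coe_substAlgHom hι, map_neg, map_mul,
        coe_substAlgHom hι, subst_invOnePlusSubOne_cyclotomic_comp, ih n (by omega),
        pow_add_two_div_succ, pow_add]
      ring

/-- `u_n(T^ι) = E^{⌊pⁿ/(p+1)⌋} u_n(T)` for `u_n = sharpPoly 0 p n`. [cite: Sprung2017, §4 Cor. 4.4] -/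
theorem subst_invOnePlusSubOne_sharpPoly_zero (n : ℕ) :
    ((((sharpPoly 0 p n).map (Int.castRingHom R) : Polynomial R) : R⟦X⟧)).subst
        (invOnePlusSubOne : R⟦X⟧) =
      (invOnePlusSubOne + 1) ^ (p ^ n / (p + 1)) *
        (((sharpPoly 0 p n).map (Int.castRingHom R) : Polynomial R) : R⟦X⟧) := by
  have h := subst_invOnePlusSubOne_sprungSeq_zero (R := R) p 0 1 n
  simpa only [sharpPoly, map_zero, map_one] using h

/-- `v_n(T^ι) = E^{⌊pⁿ/(p+1)⌋} v_n(T)` for `v_n = flatPoly 0 p n`. [cite: Sprung2017, §4 Cor. 4.4] -/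
theorem subst_invOnePlusSubOne_flatPoly_zero (n : ℕ) :
    ((((flatPoly 0 p n).map (Int.castRingHom R) : Polynomial R) : R⟦X⟧)).subst
        (invOnePlusSubOne : R⟦X⟧) =
      (invOnePlusSubOne + 1) ^ (p ^ n / (p + 1)) *
        (((flatPoly 0 p n).map (Int.castRingHom R) : Polynomial R) : R⟦X⟧) := by
  have h := subst_invOnePlusSubOne_sprungSeq_zero (R := R) p 1 0 n
  simpa only [flatPoly, map_zero, map_one] using h

end Homogeneity

/-! ## §4. The `p`-adic exponents `a = −p/(p+1)`, `b = −1/(p+1)` interpolate the `ι`-weights -/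

section Exponents

variable {p : ℕ} [hp : Fact p.Prime]

/-- `p + 1` is a unit of `ℤ_p` (private plumbing). [folklore] -/
private theorem isUnit_natCast_add_one' : IsUnit ((p : ℤ_[p]) + 1) := by
  rw [PadicInt.isUnit_iff]
  have hcast : ((p : ℤ_[p]) + 1) = (((p : ℤ) + 1 : ℤ) : ℤ_[p]) := by push_cast; rfl
  rw [hcast]
  refine le_antisymm (PadicInt.norm_le_one _) (not_lt.mp fun hlt ↦ ?_)
  rw [PadicInt.norm_int_lt_one_iff_dvd, Int.dvd_add_right (dvd_refl _)] at hlt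
  have h1 : (p : ℤ) = 1 := Int.eq_one_of_dvd_one (by positivity) hlt
  exact hp.out.one_lt.ne' (by exact_mod_cast h1)

/-- `(p+1)·⌊p^{2k+1}/(p+1)⌋ + p = p^{2k+1}` (`p ≡ −1 (mod p+1)`; private plumbing). [folklore] -/
private theorem succ_mul_pow_div_succ_odd (k : ℕ) :
    (p + 1) * (p ^ (2 * k + 1) / (p + 1)) + p = p ^ (2 * k + 1) := by
  have hp1 : 1 ≤ p := hp.out.one_lt.le
  have hsq : p ^ 2 % (p + 1) = 1 := by
    have h : p ^ 2 = 1 + (p + 1) * (p - 1) := by zify [hp1]; ring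
    rw [h, Nat.add_mul_mod_self_left, Nat.mod_eq_of_lt (by omega)]
  have hmod : p ^ (2 * k + 1) % (p + 1) = p := by
    rw [pow_succ, pow_mul, Nat.mul_mod, Nat.pow_mod, hsq, one_pow, Nat.one_mod_eq_one.mpr (by omega),
      one_mul, Nat.mod_mod, Nat.mod_eq_of_lt (Nat.lt_succ_self p)]
  have := Nat.div_add_mod (p ^ (2 * k + 1)) (p + 1)
  omega

/-- `(p+1)·⌊p^{2k}/(p+1)⌋ + 1 = p^{2k}` (private plumbing). [folklore] -/
private theorem succ_mul_pow_div_succ_even (k : ℕ) :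
    (p + 1) * (p ^ (2 * k) / (p + 1)) + 1 = p ^ (2 * k) := by
  have hp1 : 1 ≤ p := hp.out.one_lt.le
  have hsq : p ^ 2 % (p + 1) = 1 := by
    have h : p ^ 2 = 1 + (p + 1) * (p - 1) := by zify [hp1]; ring
    rw [h, Nat.add_mul_mod_self_left, Nat.mod_eq_of_lt (by omega)]
  have hmod : p ^ (2 * k) % (p + 1) = 1 := by
    rw [pow_mul, Nat.pow_mod, hsq, one_pow, Nat.one_mod_eq_one.mpr (by omega)]
  have := Nat.div_add_mod (p ^ (2 * k)) (p + 1)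
  omega

/-- **`a = −p/(p+1) ∈ ℤ_p` interpolates the odd-level weights**: if `(p+1)a = −p` then
`a ≡ ⌊pⁿ/(p+1)⌋ (mod pⁿ)` for every ODD `n`. [cite: Sprung2017, §3.5 (W⁺ = ∏(1+T)^{−p^{2j−1}(p−1)})] -/
theorem toZModPow_eq_pow_div_succ_of_odd {a : ℤ_[p]} (ha : ((p : ℤ_[p]) + 1) * a = -(p : ℤ_[p]))
    (k : ℕ) :
    PadicInt.toZModPow (2 * k + 1) a = ((p ^ (2 * k + 1) / (p + 1) : ℕ) : ZMod (p ^ (2 * k + 1))) := by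
  set n := 2 * k + 1 with hn
  obtain ⟨v, hv⟩ := isUnit_natCast_add_one' (p := p)
  set u : ℤ_[p] := ↑v⁻¹ with hu
  have hvu : ((p : ℤ_[p]) + 1) * u = 1 := by rw [← hv, hu, Units.mul_inv]
  have h3 : ((p : ℤ_[p]) + 1) * ((p ^ n / (p + 1) : ℕ) : ℤ_[p]) + p = (p : ℤ_[p]) ^ n := by
    exact_mod_cast succ_mul_pow_div_succ_odd (p := p) k
  have hdiff : a - ((p ^ n / (p + 1) : ℕ) : ℤ_[p]) = (p : ℤ_[p]) ^ n * (-u) := by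
    linear_combination u * ha - u * h3 - (a - ((p ^ n / (p + 1) : ℕ) : ℤ_[p])) * hvu
  have hker : a - ((p ^ n / (p + 1) : ℕ) : ℤ_[p]) ∈ RingHom.ker (PadicInt.toZModPow (p := p) n) := by
    rw [PadicInt.ker_toZModPow, Ideal.mem_span_singleton]
    exact ⟨-u, by rw [hdiff]⟩
  rw [RingHom.mem_ker, map_sub, map_natCast, sub_eq_zero] at hker
  exact hker

/-- **`b = −1/(p+1) ∈ ℤ_p` interpolates the even-level weights**: if `(p+1)b = −1` then
`b ≡ ⌊pⁿ/(p+1)⌋ (mod pⁿ)` for every EVEN `n`. [cite: Sprung2017, §3.5 (W⁻ = ∏(1+T)^{−p^{2j−2}(p−1)})] -/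
theorem toZModPow_eq_pow_div_succ_of_even {b : ℤ_[p]} (hb : ((p : ℤ_[p]) + 1) * b = -1) (k : ℕ) :
    PadicInt.toZModPow (2 * k) b = ((p ^ (2 * k) / (p + 1) : ℕ) : ZMod (p ^ (2 * k))) := by
  set n := 2 * k with hn
  obtain ⟨v, hv⟩ := isUnit_natCast_add_one' (p := p)
  set u : ℤ_[p] := ↑v⁻¹ with hu
  have hvu : ((p : ℤ_[p]) + 1) * u = 1 := by rw [← hv, hu, Units.mul_inv]
  have h3 : ((p : ℤ_[p]) + 1) * ((p ^ n / (p + 1) : ℕ) : ℤ_[p]) + 1 = (p : ℤ_[p]) ^ n := by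
    exact_mod_cast succ_mul_pow_div_succ_even (p := p) k
  have hdiff : b - ((p ^ n / (p + 1) : ℕ) : ℤ_[p]) = (p : ℤ_[p]) ^ n * (-u) := by
    linear_combination u * hb - u * h3 - (b - ((p ^ n / (p + 1) : ℕ) : ℤ_[p])) * hvu
  have hker : b - ((p ^ n / (p + 1) : ℕ) : ℤ_[p]) ∈ RingHom.ker (PadicInt.toZModPow (p := p) n) := by
    rw [PadicInt.ker_toZModPow, Ideal.mem_span_singleton]
    exact ⟨-u, by rw [hdiff]⟩
  rw [RingHom.mem_ker, map_sub, map_natCast, sub_eq_zero] at hker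
  exact hker

end Exponents

end Literature.NumberTheory.EllipticCurves.Sprung2017

end
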